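import Summits.AtomisticToContinuum.Crystallization.Theorems.OverbindingBudgetAffineRunCutLaminate

/-!
# `OverbindingBudget` / crux `RobustDefectLimitWindows` (stmt-AtomisticToContinuum-31280) — «RunCut» part 26a «LEDGER»:
# THE DRIFT LEDGER OF THE TIGHT BALL (EVERY SITE OF `B(y i, 35/2 ν_i)` IS `≤ 35` REGISTERED BONDS FROM THE CORE, INSIDE THE BALL) AND ITS TEXTURE: ONE AXIS

Support file (lens-4 g93; order of record (2c), `ρ₁ = 30` FINAL-in-practice, `R_t = 35/2`; booked crit r1650 (R2)/(R4) «26a DRIFT LEDGER (Lean)» + «26c texture (h-rich)»;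
memo `g93/memo/LEDGER-g93.md`; architecture `g92/memo/LAMINATE-g92.md` §4, `g91/memo/UNIAX-g91.md` §3).  The texture induction of part 26 carries the
core axis `N_a` of a mover's tight ball along chains of first-shell registrations (23B-β `leg_carry`: drift `33/10⁵` per bond, kill threshold
`1/3 + 246/10⁵ + t·33/10⁵ ≤ 87/250` for `t ≤ 36` bonds, 23B-β `cos_budget`), and the kill is available ONLY against sites of the tight ball (25
`core_polarises`: `|cos| > 87/250` within `35/2 ν_i`).  So the ledger to certify is (crit r1650 (R2), priced): from an h-site `a` of the core
(`dist(y a, y i) ≤ 3 ν_i`) EVERY site `s` of the tight ball is the end of a chain of `≤ 35 ≤ 36` registered bonds ALL OF WHOSE SITES LIE IN THE TIGHT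
BALL.  A single greedy walk `a → s` or `s → a` does not do it (its containment ball `B(target, dist)` reaches `20.5 ν_i` from the mover, outside the
kill radius); the ledger is: greedy walk `s → i` (containment ball `B(y i, dist(y s, y i)) ⊆` tight ball; ratio `R₀ ≤ 17.5·1.0111/0.936 = 18.904 ≤
19.03`, a 28-rung envelope, arrival by bond `30`), then the point walk `i → y a` of part 24 (`R₀ ≤ 3 ≤ 3.17`, `≤ 5` bonds, sites within `6 ν_i`;
arrival within `ν` of `y a` forces the end to BE `a`), appended (`≤ 35` bonds) and REVERSED bond by bond through the exact dictionary's back-pointer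
(CompressedCutEstablish `bond_exact`: `w₀ ∈ P_k`, `f_k w₀ = y_p`, `‖w₀‖ = ‖R₁ w₀‖ = ‖−u‖ = 1`).
* §1 `leg_envelope_long` — the 28-rung extension of LegCover `leg_envelope` (pure reals): rungs `10.78 < 11.42 < 12.06 < 12.7 < 13.34 < 13.98 <
  14.62 < 15.25 < 15.88 < 16.51 < 17.14 < 17.77 < 18.4 < 19.03` with `G(τ_k) ≤ τ_{k−1}²` (exact decimals by `norm_num`), restarted on the tree's
  15-rung envelope: from `R t₀ ≤ 19.03` the leg stops (`R ≤ 3/2`) within `28` steps.  `bondchain_append` — concatenation of two registered chains with a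
  site predicate (pure bookkeeping, no chart hypothesis).
* §2 (section `Atlas`) `long_walk` — 23C-α `greedy_walk` VERBATIM with the long envelope: start ratio `≤ 1903/100`, arrival by bond `30`;
  `bond_reverse`, `bondchain_reverse`, `walk_reverse` — a registered chain inside the chart ball reverses into a registered chain (same sites, same length);
  ★★ `core_ledger` — THE LEDGER: `ρ₁ ≥ 30`, mover `i` (`dist(y i, y j) ≤ 5/2 ν_j`), `dist(y a, y i) ≤ 3 ν_i`, `dist(y s, y i) ≤ 35/2 ν_i` ⟹ a chain
  `a = c 0 → … → c n = s` of first-shell registrations, `n ≤ 35`, every site within `35/2 ν_i` of the mover and inside the chart ball.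
* §3 ★★ `tight_ball_uniaxial` — THE TEXTURE CONSEQUENCE (crit r1650 «26c», h-rich): the core axis `N_a` carried along the ledger chain by 23B-β
  `leg_carry` (drift `33/10⁵` per bond, `≤ 35` bonds) is either delivered `±`-aligned or meets a reading `|cos| ≤ 87/250` at a chain site — which lies IN
  the tight ball, where 25 `core_polarises` forbids it: EVERY chart-hcp site within `35/2 ν_i` of the mover has axis `± N_a` to `35·33/10⁵ = 1155/10⁵`;
  ★★ `tight_ball_texture` — the same with `‖N_a‖ = 1` (22D-β `unit_axis`), quantified over the tight ball: ONE STACKING AXIS PER TIGHT BALL.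
NOT in this part: the PHIFF interface (laminar caps + rule-2 statement, part 26b, ≤ 150 l, definitions) which consumes `tight_ball_texture` and 25
`sheets_laminar`; the h-poor residual (part 26d; no h-poor geometry before the interface is typed, crit r1650 (R3)).
[this file: 0 definitions; imports `…RunCutLaminate` (part 25, tree) only; standard axioms]
-/

namespace Summit.AtomisticToContinuum.Crystallization.Theorems.OverbindingBudgetAffineRunCutLedger

open scoped InnerProductSpace
open Literature.Geometry.DiscreteGeometry
open Summit.AtomisticToContinuum.Crystallization.Theorems.OverbindingBudgetAffineCompressedCutEstablish (nearestDist_pos_of_frame bond_exact)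
open Summit.AtomisticToContinuum.Crystallization.Theorems.OverbindingBudgetAffineRunCutLegCover (space_step leg_law_normalise leg_envelope)
open Summit.AtomisticToContinuum.Crystallization.Theorems.OverbindingBudgetAffineRunCutSheetCrossing (unit_axis)
open Summit.AtomisticToContinuum.Crystallization.Theorems.OverbindingBudgetAffineRunCutLeg (bond_windows leg_carry cos_budget)
open Summit.AtomisticToContinuum.Crystallization.Theorems.OverbindingBudgetAffineRunCutWalk (law_below law_arrive)
open Summit.AtomisticToContinuum.Crystallization.Theorems.OverbindingBudgetAffineRunCutUniax (point_walk mover_window)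
open Summit.AtomisticToContinuum.Crystallization.Theorems.OverbindingBudgetAffineRunCutLaminate (tight_site core_polarises)

variable {N : ℕ}
local notation "E3" => EuclideanSpace ℝ (Fin 3)

/-! ## §1 The long envelope and chain bookkeeping (no chart hypothesis) -/

/-- **THE LONG LEG ENVELOPE.**  `R` nonnegative; the normalised law `R'² ≤ 1.0067 (R² − 1.412 R + 1.0023)` required only WHILE THE LEG RUNS (times
`t₀ + s`, `s < T`, no earlier time at the stop threshold `3/2`): from `R t₀ ≤ 1903/100` the leg stops (`R ≤ 3/2`) within `28` steps.  Rungs `16 … 28`: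
`571/50, 603/50, 127/10, 667/50, 699/50, 731/50, 61/4, 397/25, 1651/100, 857/50, 1777/100, 92/5, 1903/100` with `G(τ_k) ≤ τ_{k−1}²` (exact decimals),
on top of TREE LegCover `leg_envelope` (`539/50` within `15`) restarted at time `t₀ + s`.  Memo LEDGER-g93 §1. [this file · kind: proof] -/
theorem leg_envelope_long (R : ℕ → ℝ) (t₀ T : ℕ) (h0 : ∀ t, 0 ≤ R t)
    (h : ∀ s, s < T → (∀ s', s' ≤ s → 3 / 2 < R (t₀ + s')) →
      R (t₀ + s + 1) ^ 2 ≤ 10067 / 10000 * (R (t₀ + s) ^ 2 - 1412 / 1000 * R (t₀ + s) + 10023 / 10000)) :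
    28 ≤ T → R t₀ ≤ 1903 / 100 → ∃ s, s ≤ 28 ∧ R (t₀ + s) ≤ 3 / 2 := by
  have rung : ∀ (b c : ℝ) (k : ℕ), 0 ≤ c → 10067 / 10000 * (b ^ 2 - 1412 / 1000 * b + 10023 / 10000) ≤ c ^ 2 →
      (∀ s, s + k ≤ T → (∀ s', s' < s → 3 / 2 < R (t₀ + s')) → R (t₀ + s) ≤ c → ∃ s'', s'' ≤ k ∧ R (t₀ + s + s'') ≤ 3 / 2) →
      ∀ s, s + (k + 1) ≤ T → (∀ s', s' < s → 3 / 2 < R (t₀ + s')) → R (t₀ + s) ≤ b → ∃ s'', s'' ≤ k + 1 ∧ R (t₀ + s + s'') ≤ 3 / 2 := by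
    intro b c k hc hbc ih s hsT hprev hsb
    rcases le_or_gt (R (t₀ + s)) (3 / 2) with hstop | hgo
    · exact ⟨0, Nat.zero_le _, by simpa using hstop⟩
    · have hall : ∀ s', s' ≤ s → 3 / 2 < R (t₀ + s') := fun s' hs' => (Nat.lt_or_eq_of_le hs').elim (hprev s') (fun e => e ▸ hgo)
      rcases OverbindingBudgetAffineRunCutLegCover.leg_envelope_step (h0 (t₀ + s + 1)) (fun _ => h s (by omega) hall) hsb hc hbc with hs' | hs'
      · exact absurd hs' (not_le.2 hgo)
      · obtain ⟨s'', hk, hR⟩ := ih (s + 1) (by omega) (fun s' hs' => hall s' (by omega)) (by rw [← add_assoc]; exact hs')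
        exact ⟨s'' + 1, by omega, by rw [show t₀ + s + (s'' + 1) = t₀ + (s + 1) + s'' by omega]; exact hR⟩
  -- base: the tree's 15-rung envelope, restarted at time `t₀ + s`
  have r15 : ∀ s, s + 15 ≤ T → (∀ s', s' < s → 3 / 2 < R (t₀ + s')) → R (t₀ + s) ≤ 539 / 50 →
      ∃ s'', s'' ≤ 15 ∧ R (t₀ + s + s'') ≤ 3 / 2 := by
    intro s hsT hprev hR
    refine (leg_envelope R (t₀ + s) (T - s) h0 (fun s₂ hs₂ hrun => ?_)).1 (by omega) hR
    have hall : ∀ s', s' ≤ s + s₂ → 3 / 2 < R (t₀ + s') := by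
      intro s' hs'
      rcases Nat.lt_or_ge s' s with hlt | hle
      · exact hprev s' hlt
      · rw [show t₀ + s' = t₀ + s + (s' - s) by omega]; exact hrun (s' - s) (by omega)
    have h1 := h (s + s₂) (by omega) hall
    rw [show t₀ + (s + s₂) = t₀ + s + s₂ by omega] at h1
    exact h1
  have r16 := rung (571 / 50) (539 / 50) 15 (by norm_num) (by norm_num) r15
  have r17 := rung (603 / 50) (571 / 50) 16 (by norm_num) (by norm_num) r16
  have r18 := rung (127 / 10) (603 / 50) 17 (by norm_num) (by norm_num) r17
  have r19 := rung (667 / 50) (127 / 10) 18 (by norm_num) (by norm_num) r18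
  have r20 := rung (699 / 50) (667 / 50) 19 (by norm_num) (by norm_num) r19
  have r21 := rung (731 / 50) (699 / 50) 20 (by norm_num) (by norm_num) r20
  have r22 := rung (61 / 4) (731 / 50) 21 (by norm_num) (by norm_num) r21
  have r23 := rung (397 / 25) (61 / 4) 22 (by norm_num) (by norm_num) r22
  have r24 := rung (1651 / 100) (397 / 25) 23 (by norm_num) (by norm_num) r23
  have r25 := rung (857 / 50) (1651 / 100) 24 (by norm_num) (by norm_num) r24
  have r26 := rung (1777 / 100) (857 / 50) 25 (by norm_num) (by norm_num) r25
  have r27 := rung (92 / 5) (1777 / 100) 26 (by norm_num) (by norm_num) r26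
  have r28 := rung (1903 / 100) (92 / 5) 27 (by norm_num) (by norm_num) r27
  intro hT hR0
  obtain ⟨s, hs, hR⟩ := r28 0 (by omega) (fun s' hs' => absurd hs' (Nat.not_lt_zero _)) (by simpa using hR0)
  exact ⟨s, hs, by simpa using hR⟩

/-- Concatenation of two registered chains `p → q` (`n₁` bonds) and `q → r` (`n₂` bonds) whose sites satisfy `S`: a registered chain `p → r` of
`n₁ + n₂` bonds whose sites satisfy `S` (pure bookkeeping). [this file · kind: proof] -/
theorem bondchain_append {y : Fin N → E3} {Pc : Fin N → Finset E3} {fc : Fin N → E3 → E3} {S : Fin N → Prop} {p q r : Fin N} {n₁ n₂ : ℕ}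
    {c₁ c₂ : ℕ → Fin N} {u₁ u₂ : ℕ → E3} (h₁0 : c₁ 0 = p) (h₁n : c₁ n₁ = q)
    (hch₁ : ∀ t < n₁, u₁ t ∈ Pc (c₁ t) ∧ ‖u₁ t‖ = 1 ∧ fc (c₁ t) (u₁ t) = y (c₁ (t + 1))) (hS₁ : ∀ t ≤ n₁, S (c₁ t))
    (h₂0 : c₂ 0 = q) (h₂n : c₂ n₂ = r)
    (hch₂ : ∀ t < n₂, u₂ t ∈ Pc (c₂ t) ∧ ‖u₂ t‖ = 1 ∧ fc (c₂ t) (u₂ t) = y (c₂ (t + 1))) (hS₂ : ∀ t ≤ n₂, S (c₂ t)) :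
    ∃ c : ℕ → Fin N, ∃ u : ℕ → E3, c 0 = p ∧ c (n₁ + n₂) = r ∧
      (∀ t < n₁ + n₂, u t ∈ Pc (c t) ∧ ‖u t‖ = 1 ∧ fc (c t) (u t) = y (c (t + 1))) ∧ (∀ t ≤ n₁ + n₂, S (c t)) := by
  refine ⟨fun t => if t < n₁ then c₁ t else c₂ (t - n₁), fun t => if t < n₁ then u₁ t else u₂ (t - n₁), ?_, ?_, fun t ht => ?_,
    fun t ht => ?_⟩
  · rcases Nat.eq_zero_or_pos n₁ with h | h
    · subst h
      simp only [lt_irrefl, if_false, Nat.sub_zero, h₂0]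
      exact h₁n.symm.trans h₁0
    · simp only [if_pos h, h₁0]
  · simp only [if_neg (show ¬ (n₁ + n₂ < n₁) by omega), Nat.add_sub_cancel_left, h₂n]
  · by_cases ht₁ : t < n₁
    · by_cases ht₁' : t + 1 < n₁
      · simp only [if_pos ht₁, if_pos ht₁']
        exact hch₁ t ht₁
      · simp only [if_pos ht₁, if_neg ht₁']
        rw [show t + 1 - n₁ = 0 by omega, h₂0, ← h₁n, show n₁ = t + 1 by omega]
        exact hch₁ t ht₁
    · simp only [if_neg ht₁, if_neg (show ¬ (t + 1 < n₁) by omega)]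
      rw [show t + 1 - n₁ = t - n₁ + 1 by omega]
      exact hch₂ (t - n₁) (by omega)
  · by_cases ht₁ : t < n₁
    · simp only [if_pos ht₁]
      exact hS₁ t ht₁.le
    · simp only [if_neg ht₁]
      exact hS₂ (t - n₁) (by omega)

section Atlas
/-! ONE chart datum on the ball `B(y j, ρ₁ ν_j)` (verbatim §2 of part 22A). -/
variable {y : Fin N → E3} (hy : Function.Injective y) {j : Fin N} {ρ₁ : ℝ}
  {Ac : Fin N → (E3 →ₗ[ℝ] E3)} {Qc : Fin N → (E3 →ₗᵢ[ℝ] E3)} {Pc : Fin N → Finset E3} {fc : Fin N → E3 → E3}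
  (hP : ∀ i, dist (y i) (y j) ≤ ρ₁ * nearestDist y j → Pc i = fccTwoShellPattern ∨ Pc i = hcpTwoShellPattern)
  (hA : ∀ i, dist (y i) (y j) ≤ ρ₁ * nearestDist y j → ∀ v ∈ Pc i, ‖Ac i v - Qc i v‖ ≤ 1 / 1000)
  (hf : ∀ i, dist (y i) (y j) ≤ ρ₁ * nearestDist y j → ∀ v ∈ Pc i,
    fc i v ∈ Set.range y ∧ dist (fc i v) (y i + nearestDist y i • Ac i v) ≤ 1 / 10 ^ 4 * nearestDist y i)
  (hinj : ∀ i, dist (y i) (y j) ≤ ρ₁ * nearestDist y j → Set.InjOn (fc i) ↑(Pc i))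
  (hex : ∀ i, dist (y i) (y j) ≤ ρ₁ * nearestDist y j → ∀ k : Fin N, k ≠ i →
    dist (y k) (y i) ≤ (3 / 2 + 1 / 450) * nearestDist y i → ∃ v ∈ Pc i, fc i v = y k)

include hy hP hA hf hinj hex

/-! ## §2 The long walk, reversal, and the ledger of the tight ball -/

/-- ★ **THE LONG GREEDY WALK ARRIVES.**  23C-α `greedy_walk` VERBATIM with the long envelope: from a charted site `p` toward a site `q` with
`dist(y p, y q) ≤ 19.03·ν_p`, the closed ball `B(y q, dist(y p, y q))` lying inside the chart ball: a chain `p = c 0 → … → c n = q` of first-shell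
registrations, `n ≤ 30`, all of whose sites stay in `B(y q, dist(y p, y q))` (`leg_envelope_long`: `R ≤ 3/2` within `28` bonds, then `law_below`,
`law_arrive`). [this file · kind: proof] -/
theorem long_walk {p q : Fin N} (hcont : ∀ z : Fin N, dist (y z) (y q) ≤ dist (y p) (y q) → dist (y z) (y j) ≤ ρ₁ * nearestDist y j)
    (hR0 : dist (y p) (y q) ≤ 1903 / 100 * nearestDist y p) :
    ∃ n, n ≤ 30 ∧ ∃ c : ℕ → Fin N, ∃ u : ℕ → E3, c 0 = p ∧ c n = q ∧
      (∀ t < n, u t ∈ Pc (c t) ∧ ‖u t‖ = 1 ∧ fc (c t) (u t) = y (c (t + 1))) ∧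
      (∀ t ≤ n, dist (y (c t)) (y q) ≤ dist (y p) (y q)) := by
  -- one greedy step from every charted site other than the target
  have key : ∀ z : Fin N, ∃ z' : Fin N, ∃ u : E3, dist (y z) (y j) ≤ ρ₁ * nearestDist y j → z ≠ q →
      u ∈ Pc z ∧ ‖u‖ = 1 ∧ fc z u = y z' ∧
        dist (y z') (y q) ^ 2 ≤ dist (y z) (y q) ^ 2 - 1412 / 1000 * nearestDist y z * dist (y z) (y q) + 10023 / 10000 * nearestDist y z ^ 2 := by
    intro z
    by_cases hz : dist (y z) (y j) ≤ ρ₁ * nearestDist y j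
    · obtain ⟨u, hu, hu1, H⟩ := space_step hy (hP z hz) (hA z hz) (hf z hz) (hinj z hz) (y q - y z)
      obtain ⟨z', hz'⟩ := (hf z hz u hu).1
      obtain ⟨-, -, hlaw⟩ := H z' hz'.symm
      refine ⟨z', u, fun _ _ => ⟨hu, hu1, hz'.symm, ?_⟩⟩
      have e1 : y q - y z - (y z' - y z) = y q - y z' := by abel
      rw [e1, ← dist_eq_norm, ← dist_eq_norm, dist_comm (y q) (y z'), dist_comm (y q) (y z)] at hlaw
      exact hlaw
    · exact ⟨z, 0, fun h _ => absurd h hz⟩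
  choose F U hFU using key
  obtain ⟨c, hc0, hcS⟩ : ∃ c : ℕ → Fin N, c 0 = p ∧ ∀ t, c (t + 1) = F (c t) :=
    ⟨fun t => Nat.rec (motive := fun _ => Fin N) p (fun _ z => F z) t, rfl, fun _ => rfl⟩
  -- the invariant while the walk has not arrived
  have inv : ∀ t : ℕ, (∀ s < t, c s ≠ q) →
      (∀ s ≤ t, dist (y (c s)) (y q) ≤ dist (y p) (y q)) ∧
      (∀ s < t, U (c s) ∈ Pc (c s) ∧ ‖U (c s)‖ = 1 ∧ fc (c s) (U (c s)) = y (c (s + 1))) ∧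
      (∀ s < t, (dist (y (c (s + 1))) (y q) / nearestDist y (c (s + 1))) ^ 2 ≤
        10067 / 10000 * ((dist (y (c s)) (y q) / nearestDist y (c s)) ^ 2
          - 1412 / 1000 * (dist (y (c s)) (y q) / nearestDist y (c s)) + 10023 / 10000)) := by
    intro t
    induction t with
    | zero =>
      intro _
      refine ⟨fun s hs => ?_, fun s hs => absurd hs (Nat.not_lt_zero _), fun s hs => absurd hs (Nat.not_lt_zero _)⟩
      obtain rfl : s = 0 := Nat.le_zero.1 hs
      rw [hc0]
    | succ t ih =>
      intro hne
      obtain ⟨hd, hch, hlw⟩ := ih (fun s hs => hne s (Nat.lt_succ_of_lt hs))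
      have hzq : c t ≠ q := hne t (Nat.lt_succ_self t)
      have hbt : dist (y (c t)) (y j) ≤ ρ₁ * nearestDist y j := hcont _ (hd t le_rfl)
      obtain ⟨hu, hu1, hfu, hl⟩ := hFU (c t) hbt hzq
      rw [← hcS] at hfu hl
      have hνpos : 0 < nearestDist y (c t) := nearestDist_pos_of_frame hy (hP _ hbt) (fun v hv => (hf _ hbt v hv).1) (hinj _ hbt)
      have hνd : nearestDist y (c t) ≤ dist (y (c t)) (y q) := nearestDist_le_dist y hzq.symm
      have hdec : dist (y (c (t + 1))) (y q) ≤ dist (y (c t)) (y q) := by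
        have h2 : dist (y (c (t + 1))) (y q) ^ 2 ≤ dist (y (c t)) (y q) ^ 2 := by
          nlinarith [hl, mul_nonneg hνpos.le (sub_nonneg.2 hνd), hνpos.le]
        exact (pow_le_pow_iff_left₀ dist_nonneg dist_nonneg two_ne_zero).1 h2
      have hd1 : dist (y (c (t + 1))) (y q) ≤ dist (y p) (y q) := hdec.trans (hd t le_rfl)
      have hbt1 : dist (y (c (t + 1))) (y j) ≤ ρ₁ * nearestDist y j := hcont _ hd1
      obtain ⟨-, ⟨hlo, -⟩, -⟩ := bond_windows hy hP hA hf hinj hex hbt hbt1 hu hu1 hfu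
      have hlawn := leg_law_normalise hνpos hlo hl
      refine ⟨fun s hs => ?_, fun s hs => ?_, fun s hs => ?_⟩
      · rcases Nat.lt_or_eq_of_le hs with hs' | rfl
        · exact hd s (Nat.lt_succ_iff.1 hs')
        · exact hd1
      · rcases Nat.lt_or_eq_of_le (Nat.lt_succ_iff.1 hs) with hs' | rfl
        · exact hch s hs'
        · exact ⟨hu, hu1, hfu⟩
      · rcases Nat.lt_or_eq_of_le (Nat.lt_succ_iff.1 hs) with hs' | rfl
        · exact hlw s hs'
        · exact hlawn
  -- arrival by bond 30
  have harr : ∃ n, n ≤ 30 ∧ c n = q := by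
    by_contra hno'
    have hno : ∀ s ≤ 30, c s ≠ q := fun s hs h => hno' ⟨s, hs, h⟩
    obtain ⟨hd, -, hlw⟩ := inv 30 (fun s hs => hno s hs.le)
    have hR1 : ∀ s ≤ 30, 1 ≤ dist (y (c s)) (y q) / nearestDist y (c s) := by
      intro s hs
      have hbs : dist (y (c s)) (y j) ≤ ρ₁ * nearestDist y j := hcont _ (hd s hs)
      have hνpos : 0 < nearestDist y (c s) := nearestDist_pos_of_frame hy (hP _ hbs) (fun v hv => (hf _ hbs v hv).1) (hinj _ hbs)
      exact (one_le_div hνpos).2 (nearestDist_le_dist y (hno s hs).symm)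
    have hR0' : ∀ s, 0 ≤ dist (y (c s)) (y q) / nearestDist y (c s) := fun s => div_nonneg dist_nonneg (nearestDist_nonneg _ _)
    have hp0 : dist (y p) (y j) ≤ ρ₁ * nearestDist y j := hcont p le_rfl
    have hνp : 0 < nearestDist y p := nearestDist_pos_of_frame hy (hP _ hp0) (fun v hv => (hf _ hp0 v hv).1) (hinj _ hp0)
    have hstart : dist (y (c 0)) (y q) / nearestDist y (c 0) ≤ 1903 / 100 := by rw [hc0, div_le_iff₀ hνp]; exact hR0
    obtain ⟨s, hs28, hs32⟩ := leg_envelope_long (fun s => dist (y (c s)) (y q) / nearestDist y (c s)) 0 28 hR0'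
      (fun s hs _ => by rw [zero_add]; exact hlw s (by omega)) le_rfl hstart
    rw [zero_add] at hs32
    have h1 := law_below (hR1 s (by omega)) hs32 (hR0' (s + 1)) (hlw s (by omega))
    have h2 := law_arrive (hR1 (s + 1) (by omega)) h1 (hR0' (s + 1 + 1)) (hlw (s + 1) (by omega))
    exact absurd (hR1 (s + 1 + 1) (by omega)) (not_le.2 h2)
  obtain ⟨n, hn30, hcn⟩ := harr
  have hexq : ∃ n, c n = q := ⟨n, hcn⟩
  obtain ⟨hd, hch, -⟩ := inv (Nat.find hexq) (fun s hs => Nat.find_min hexq hs)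
  exact ⟨Nat.find hexq, (Nat.find_min' hexq hcn).trans hn30, c, fun t => U (c t), hc0, Nat.find_spec hexq, hch, hd⟩

/-- A registered first-shell bond `p → k` inside the chart ball reverses: some first-shell label `w ∈ P_k`, `‖w‖ = 1`, registers `p` at `k`
(CompressedCutEstablish `bond_exact`: the exact dictionary's back-pointer `w₀`, `R₁ w₀ = −u`). [this file · kind: proof] -/
theorem bond_reverse {p k : Fin N} (hp : dist (y p) (y j) ≤ ρ₁ * nearestDist y j) (hk : dist (y k) (y j) ≤ ρ₁ * nearestDist y j)
    {u : E3} (hu : u ∈ Pc p) (hu1 : ‖u‖ = 1) (hfu : fc p u = y k) : ∃ w ∈ Pc k, ‖w‖ = 1 ∧ fc k w = y p := by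
  obtain ⟨-, -, -, R₁, -, hD⟩ := bond_exact hy hP hA hf hinj hex hp hk hu hu1 hfu
  obtain ⟨w₀, hw₀, hfw₀, hRw₀⟩ := hD.1
  exact ⟨w₀, hw₀, by rw [← R₁.norm_map w₀, hRw₀, norm_neg, hu1], hfw₀⟩

/-- A registered chain of `n` bonds all of whose sites lie in the chart ball reverses bond by bond: labels `u' t ∈ P_{c (n − t)}` registering
`c (n − (t+1))`. [this file · kind: proof] -/
theorem bondchain_reverse (c : ℕ → Fin N) (u : ℕ → E3) (n : ℕ) (hball : ∀ t ≤ n, dist (y (c t)) (y j) ≤ ρ₁ * nearestDist y j)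
    (hch : ∀ t < n, u t ∈ Pc (c t) ∧ ‖u t‖ = 1 ∧ fc (c t) (u t) = y (c (t + 1))) :
    ∃ u' : ℕ → E3, ∀ t < n, u' t ∈ Pc (c (n - t)) ∧ ‖u' t‖ = 1 ∧ fc (c (n - t)) (u' t) = y (c (n - (t + 1))) := by
  have key : ∀ t : ℕ, ∃ w : E3, t < n → w ∈ Pc (c (n - t)) ∧ ‖w‖ = 1 ∧ fc (c (n - t)) w = y (c (n - (t + 1))) := by
    intro t
    by_cases ht : t < n
    · obtain ⟨hu, hu1, hfu⟩ := hch (n - (t + 1)) (by omega)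
      rw [show n - (t + 1) + 1 = n - t by omega] at hfu
      obtain ⟨w, hw, hw1, hfw⟩ := bond_reverse hy hP hA hf hinj hex (hball _ (by omega)) (hball _ (by omega)) hu hu1 hfu
      exact ⟨w, fun _ => ⟨hw, hw1, hfw⟩⟩
    · exact ⟨0, fun h => absurd h ht⟩
  choose u' hu' using key
  exact ⟨u', hu'⟩

/-- ★ **WALKS REVERSE.**  A registered chain `p = c 0 → … → c n = q` whose sites satisfy a predicate `S` implying membership of the chart ball
reverses into a registered chain `q → … → p` of the same length whose sites satisfy `S`. [this file · kind: proof] -/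
theorem walk_reverse {p q : Fin N} {n : ℕ} {c : ℕ → Fin N} {u : ℕ → E3} (hc0 : c 0 = p) (hcn : c n = q)
    (hch : ∀ t < n, u t ∈ Pc (c t) ∧ ‖u t‖ = 1 ∧ fc (c t) (u t) = y (c (t + 1))) {S : Fin N → Prop} (hS : ∀ t ≤ n, S (c t))
    (hSball : ∀ z, S z → dist (y z) (y j) ≤ ρ₁ * nearestDist y j) :
    ∃ c' : ℕ → Fin N, ∃ u' : ℕ → E3, c' 0 = q ∧ c' n = p ∧
      (∀ t < n, u' t ∈ Pc (c' t) ∧ ‖u' t‖ = 1 ∧ fc (c' t) (u' t) = y (c' (t + 1))) ∧ (∀ t ≤ n, S (c' t)) := by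
  obtain ⟨u', hu'⟩ := bondchain_reverse hy hP hA hf hinj hex c u n (fun t ht => hSball _ (hS t ht)) hch
  exact ⟨fun t => c (n - t), u', by simp only [Nat.sub_zero, hcn], by simp only [Nat.sub_self, hc0], hu', fun t _ => hS _ (Nat.sub_le n t)⟩

/-- ★★ **THE DRIFT LEDGER OF THE TIGHT BALL.**  `ρ₁ ≥ 30`, a mover `i` (`dist(y i, y j) ≤ 5/2 ν_j`), a core site `a` (`dist(y a, y i) ≤ 3 ν_i`) and ANY
site `s` of the tight ball (`dist(y s, y i) ≤ 35/2 ν_i`): a chain `a = c 0 → … → c n = s` of first-shell registrations, `n ≤ 35`, EVERY site of which lies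
in the tight ball `B(y i, 35/2 ν_i)` and in the chart ball.  Construction: `long_walk` `s → i` (`R₀ ≤ 17.5·1.0111/0.936 ≤ 19.03` by 24 `mover_window`,
25 `tight_site`; sites in `B(y i, dist(y s, y i))`), then 24 `point_walk` `i → y a` (`R₀ ≤ 3 ≤ 3.17`, sites within `6 ν_i`; arrival within `ν` of
`y a` forces the end to be `a`, `nearestDist_le_dist`), `bondchain_append`, `walk_reverse`.  Memo LEDGER-g93 §2. [this file · kind: proof] -/
theorem core_ledger (hρ : 30 ≤ ρ₁) {i : Fin N} (hi : dist (y i) (y j) ≤ 5 / 2 * nearestDist y j) {a s : Fin N}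
    (ha : dist (y a) (y i) ≤ 3 * nearestDist y i) (hs : dist (y s) (y i) ≤ 35 / 2 * nearestDist y i) :
    ∃ n, n ≤ 35 ∧ ∃ c : ℕ → Fin N, ∃ u : ℕ → E3, c 0 = a ∧ c n = s ∧
      (∀ t < n, u t ∈ Pc (c t) ∧ ‖u t‖ = 1 ∧ fc (c t) (u t) = y (c (t + 1))) ∧
      (∀ t ≤ n, dist (y (c t)) (y i) ≤ 35 / 2 * nearestDist y i ∧ dist (y (c t)) (y j) ≤ ρ₁ * nearestDist y j) := by
  have hν0 : 0 ≤ nearestDist y j := nearestDist_nonneg _ _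
  have hνi0 : 0 ≤ nearestDist y i := nearestDist_nonneg _ _
  obtain ⟨-, -, hνihi⟩ := mover_window hy hP hA hf hinj hex (by linarith) hi
  -- every site of the tight ball is charted
  have hSball : ∀ z : Fin N, dist (y z) (y i) ≤ 35 / 2 * nearestDist y i → dist (y z) (y j) ≤ ρ₁ * nearestDist y j :=
    fun z hz => (tight_site hy hP hA hf hinj hex hρ hi (by norm_num) (by norm_num) hz).2.1
  -- walk 1: `s → i`, inside `B(y i, dist(y s, y i))`
  have hcont₁ : ∀ z : Fin N, dist (y z) (y i) ≤ dist (y s) (y i) → dist (y z) (y j) ≤ ρ₁ * nearestDist y j :=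
    fun z hz => hSball z (hz.trans hs)
  obtain ⟨-, -, hνs, -⟩ := tight_site hy hP hA hf hinj hex hρ hi (by norm_num) (by norm_num) hs
  have hR₁ : dist (y s) (y i) ≤ 1903 / 100 * nearestDist y s := by linarith
  obtain ⟨n₁, hn₁, c₁, u₁, hc₁0, hc₁n, hch₁, hd₁⟩ := long_walk hy hP hA hf hinj hex hcont₁ hR₁
  -- walk 2: `i →` the point `y a`, inside `B(y a, dist(y i, y a)) ⊆ B(y i, 6 ν_i)`
  have hia : dist (y i) (y a) ≤ 3 * nearestDist y i := by rw [dist_comm]; exact ha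
  have hcont₂ : ∀ z : Fin N, dist (y z) (y a) ≤ dist (y i) (y a) → dist (y z) (y j) ≤ ρ₁ * nearestDist y j := by
    intro z hz
    have h1 := dist_triangle (y z) (y a) (y i)
    exact hSball z (by linarith)
  obtain ⟨n₂, hn₂, c₂, u₂, hc₂0, harr, hch₂, hd₂⟩ := point_walk hy hP hA hf hinj hex hcont₂ (by linarith)
  have hc₂n : c₂ n₂ = a := by
    by_contra h
    exact absurd (nearestDist_le_dist y (fun e : a = c₂ n₂ => h e.symm)) (not_le.2 harr)
  -- append `s → i → a`, reverse
  obtain ⟨c, u, hc0, hcn, hch, hS⟩ := bondchain_append (S := fun z => dist (y z) (y i) ≤ 35 / 2 * nearestDist y i) hc₁0 hc₁n hch₁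
    (fun t ht => (hd₁ t ht).trans hs) hc₂0 hc₂n hch₂ (fun t ht => by
      have h1 := dist_triangle (y (c₂ t)) (y a) (y i)
      have h2 := hd₂ t ht
      show dist (y (c₂ t)) (y i) ≤ 35 / 2 * nearestDist y i
      linarith)
  obtain ⟨c', u', hc'0, hc'n, hch', hS'⟩ := walk_reverse hy hP hA hf hinj hex hc0 hcn hch
    (S := fun z => dist (y z) (y i) ≤ 35 / 2 * nearestDist y i) hS hSball
  exact ⟨n₁ + n₂, by omega, c', u', hc'0, hc'n, hch', fun t ht => ⟨hS' t ht, hSball _ (hS' t ht)⟩⟩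

/-! ## §3 The texture of the tight ball: one axis -/

/-- ★★ **THE TIGHT BALL IS UNIAXIAL.**  `ρ₁ ≥ 30`, a mover `i`, a core h-site `a` (`dist(y a, y i) ≤ 3 ν_i`) and ANY h-site `m` of the tight ball
(`dist(y m, y i) ≤ 35/2 ν_i`): the chart axis of `m` is `± N_a` to `35·33/10⁵ = 0.01155`.  The core axis is carried along the ledger chain `a → … → m`
(`core_ledger`, `≤ 35` bonds inside the tight ball) by 23B-β `leg_carry`: either every h-site of the chain is `±`-aligned (drift `33/10⁵` per bond), or some
h-site `c t` of the chain reads `|cos| ≤ 1/3 + 246/10⁵ + t·33/10⁵ ≤ 87/250` (`t ≤ 35 ≤ 36`, 23B-β `cos_budget`) — impossible INSIDE the tight ball, where the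
core sheet polarises every h-site (25 `core_polarises`: `|cos| > 87/250`).  Memo LEDGER-g93 §3. [this file · kind: proof] -/
theorem tight_ball_uniaxial (hρ : 30 ≤ ρ₁) {i : Fin N} (hi : dist (y i) (y j) ≤ 5 / 2 * nearestDist y j) {nA : Fin N → E3}
    (hnA : ∀ k, nA k = (‖Ac k ((Real.sqrt 18)⁻¹ • intVec ![4, 4, 4])‖⁻¹) • Ac k ((Real.sqrt 18)⁻¹ • intVec ![4, 4, 4]))
    {a m : Fin N} (hPa : Pc a = hcpTwoShellPattern) (hPm : Pc m = hcpTwoShellPattern)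
    (ha : dist (y a) (y i) ≤ 3 * nearestDist y i) (hm : dist (y m) (y i) ≤ 35 / 2 * nearestDist y i) :
    ∃ σ : ℝ, (σ = 1 ∨ σ = -1) ∧ ‖nA m - σ • nA a‖ ≤ 35 * (33 / 10 ^ 5) := by
  obtain ⟨n, hn, c, u, hc0, hcn, hch, hS⟩ := core_ledger hy hP hA hf hinj hex hρ hi ha hm
  have h0 : Pc (c 0) = hcpTwoShellPattern := by rw [hc0]; exact hPa
  rcases leg_carry hy hP hA hf hinj hex c u hnA h0 n (fun t ht => (hS t ht).2) hch with ⟨t, -, htn, hPt, hcos⟩ | ⟨halign, -⟩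
  · -- a foreign reading inside the tight ball: excluded by the core sheet
    have hkill := core_polarises hy hP hA hf hinj hex hρ hi hPa hPt ha (hS t htn).1 (hnA a) (hnA (c t))
    rw [hc0] at hcos
    have hb := cos_budget (t := t) (t' := 0) (by omega)
    push_cast at hb
    linarith
  · obtain ⟨σ, hσ, hd⟩ := halign n le_rfl (by rw [hcn]; exact hPm)
    rw [hcn, hc0] at hd
    have hn' : (n : ℝ) ≤ 35 := by exact_mod_cast hn
    exact ⟨σ, hσ, hd.trans (by nlinarith)⟩

/-- ★★ **THE TEXTURE OF THE TIGHT BALL.**  With a core h-site `a` within `3 ν_i` of a mover, `N_a` is a unit vector and EVERY chart-hcp site within `35/2 ν_i`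
of the mover has chart axis `± N_a` to `1155/10⁵`: the tight ball has ONE stacking axis (the h-rich texture statement consumed by the PHIFF interface of
part 26b; `unit_axis` of 22D-β for the norm). [this file · kind: proof] -/
theorem tight_ball_texture (hρ : 30 ≤ ρ₁) {i : Fin N} (hi : dist (y i) (y j) ≤ 5 / 2 * nearestDist y j) {nA : Fin N → E3}
    (hnA : ∀ k, nA k = (‖Ac k ((Real.sqrt 18)⁻¹ • intVec ![4, 4, 4])‖⁻¹) • Ac k ((Real.sqrt 18)⁻¹ • intVec ![4, 4, 4]))
    {a : Fin N} (hPa : Pc a = hcpTwoShellPattern) (ha : dist (y a) (y i) ≤ 3 * nearestDist y i) :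
    ‖nA a‖ = 1 ∧ ∀ m : Fin N, Pc m = hcpTwoShellPattern → dist (y m) (y i) ≤ 35 / 2 * nearestDist y i →
      ∃ σ : ℝ, (σ = 1 ∨ σ = -1) ∧ ‖nA m - σ • nA a‖ ≤ 1155 / 10 ^ 5 := by
  refine ⟨?_, fun m hPm hm => ?_⟩
  · have hballa := (tight_site hy hP hA hf hinj hex hρ hi (by norm_num) (by norm_num) ha).2.1
    rw [hnA a]
    exact (unit_axis hy hA hf hinj hex hballa hPa).1
  · obtain ⟨σ, hσ, h⟩ := tight_ball_uniaxial hy hP hA hf hinj hex hρ hi hnA hPa hPm ha hm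
    exact ⟨σ, hσ, h.trans (by norm_num)⟩

end Atlas

end Summit.AtomisticToContinuum.Crystallization.Theorems.OverbindingBudgetAffineRunCutLedger
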